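import Mathlib
import HarnessLib
import Summits.Ventures.LatticeQCDFlow.Exactness.GroupMetropolisLinkErgodic
import Summits.Ventures.LatticeQCDFlow.Exactness.LeapfrogHMCDoeblin

/-!
# Boxes around a configuration: walk minorants are product Haar on a box, a ball sits in every box, and the Gibbs law of a pinched weight is comparable to product Haar

HONEST FRAMING: exact (Metropolis-corrected) sampling algorithms for lattice gauge theory;
figures of merit are autocorrelation/cost numbers at stated couplings and volumes; no
continuum-physics claim.

Venture `LatticeQCDFlow` (cell pub-lqcd), topic `Exactness`, FANOUT row 9 (eng-latcore; a leaf of the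
'update + over-relaxation' composite line — HOME/eng-latcore/lean-sources/gen21/README.md — used by
`ExactStepBoxMinorised.lean`).  NEW WORK of the cell over the tree (`SymmetricMetropolis.lean` /
`ConnectedGroupKickCovering.lean`: `mulWalk`, `mulWalk_apply`, `smul_mulWalk_le`; `GroupMetropolisLinkErgodic.lean`:
`gibbsProbability`; `LeapfrogHMCDoeblin.lean`: `smul_pi_le_pi`) and Mathlib (`Measure.restrict_pi_pi`, right
invariance of product measures, `nhdsSet_diagonal_eq_uniformity`).  Nothing is cited as a fact; no number is claimed.

* §1 `mulWalk_pi_restrict_box` — `mulWalk ((⊗μ)|_{Π V'}) U = (⊗μ)|_{ {W : W_j U_j⁻¹ ∈ V'} }` (right invariance);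
  **`smul_restrict_box_le_mulWalk_pi`** — `c_j • μ|_{V'} ≤ ρ_j` for every link gives
  `(∏ c_j) • (⊗μ)|_{box(U)} ≤ mulWalk (⊗ρ) U`.
* §2 `gibbsProbability_le_smul`, `smul_le_gibbsProbability` (the Gibbs law of a weight pinched `m ≤ w ≤ M` against
  the reference measure).
* §3 **`exists_ball_subset_box`** — on a compact group with a compatible pseudo-metric (and the sup pseudo-metric on
  `ι → G`), for an open `V' ∋ 1` some radius `r > 0` has `B(U, r) ⊆ box(U)` for EVERY `U` (the uniformity of a
  compact space is the neighbourhood filter of the diagonal).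

NOT CLAIMED: any quantitative constant.
-/

noncomputable section

namespace Summit.Ventures.LatticeQCDFlow.Exactness

open MeasureTheory Measure Metric Set Filter Topology Function ProbabilityTheory ProbabilityTheory.Kernel
open Literature.MathematicalPhysics.QuantumFieldTheory (haarProbability)
open scoped ENNReal Uniformity

/-! ## §1 Boxes around a configuration -/

section Box

variable {ι : Type*} [Fintype ι] {G : Type*} [Group G] [MeasurableSpace G] [MeasurableMul₂ G]
  {μH : Measure G} [SigmaFinite μH] [μH.IsMulRightInvariant]

/-- **The walk with the boxed product law is the product law on the box around the start**:
`mulWalk ((⊗μ)|_{Π V'}) U = (⊗μ)|_{ {W : ∀ j, W_j U_j⁻¹ ∈ V'} }` (right invariance of `⊗μ`). -/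
theorem mulWalk_pi_restrict_box (V' : Set G) (U : ι → G) :
    mulWalk ((Measure.pi fun _ : ι => μH).restrict (Set.pi univ fun _ => V')) U =
      (Measure.pi fun _ : ι => μH).restrict {W | ∀ j, W j * (U j)⁻¹ ∈ V'} := by
  refine Measure.ext fun E hE => ?_
  have hbox : (fun X : ι → G => X * U) ⁻¹' {W | ∀ j, W j * (U j)⁻¹ ∈ V'} = Set.pi univ fun _ => V' := by
    ext X
    simp only [mem_preimage, mem_setOf_eq, Pi.mul_apply, mul_inv_cancel_right, mem_univ_pi]
  rw [mulWalk_apply, Measure.map_apply (measurable_mul_const U) hE, Measure.restrict_apply (measurable_mul_const U hE),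
    Measure.restrict_apply hE, ← measure_preimage_mul_right (Measure.pi fun _ : ι => μH) U (E ∩ _), preimage_inter, hbox]

/-- **Coordinatewise minorants near `1` give product Haar on the box**: if `c_j • μ|_{V'} ≤ ρ_j` for every
link `j`, then `(∏ c_j) • (⊗μ)|_{box(U)} ≤ mulWalk (⊗ρ) U` for every `U`. -/
theorem smul_restrict_box_le_mulWalk_pi {ρ : ι → Measure G} [∀ j, SigmaFinite (ρ j)] {c : ι → ℝ≥0∞}
    {V' : Set G} (h : ∀ j, c j • μH.restrict V' ≤ ρ j) (U : ι → G) :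
    (∏ j, c j) • (Measure.pi fun _ : ι => μH).restrict {W | ∀ j, W j * (U j)⁻¹ ∈ V'} ≤ mulWalk (Measure.pi ρ) U := by
  classical
  have hpi : (∏ j, c j) • (Measure.pi fun _ : ι => μH).restrict (Set.pi univ fun _ => V') ≤ Measure.pi ρ := by
    rw [Measure.restrict_pi_pi]
    exact smul_pi_le_pi h
  rw [← mulWalk_pi_restrict_box]
  exact smul_mulWalk_le hpi U

end Box

/-! ## §2 The Gibbs law of a pinched weight is comparable to the reference measure -/

section Gibbs

variable {Ω : Type*} [MeasurableSpace Ω] (μ : Measure Ω) {p : Ω → ℝ} {m M : ℝ}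

/-- The Gibbs law of a weight `≤ M` is below `(Z⁻¹ M) ·` the reference measure. -/
theorem gibbsProbability_le_smul (hpM : ∀ x, p x ≤ M) :
    gibbsProbability μ p ≤ (((μ.withDensity fun x => ENNReal.ofReal (p x)) univ)⁻¹ * ENNReal.ofReal M) • μ := by
  rw [gibbsProbability, ← smul_smul]
  refine Measure.le_iff'.2 fun E => ?_
  simp only [Measure.smul_apply, smul_eq_mul]
  refine mul_le_mul' le_rfl ?_
  calc (μ.withDensity fun x => ENNReal.ofReal (p x)) E
      ≤ (μ.withDensity fun _ => ENNReal.ofReal M) E :=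
        withDensity_mono (Eventually.of_forall fun x => ENNReal.ofReal_le_ofReal (hpM x)) E
    _ = ENNReal.ofReal M * μ E := by rw [withDensity_const, Measure.smul_apply, smul_eq_mul]

/-- The Gibbs law of a weight `≥ m` is above `(Z⁻¹ m) ·` the reference measure. -/
theorem smul_le_gibbsProbability (hpm : ∀ x, m ≤ p x) :
    (((μ.withDensity fun x => ENNReal.ofReal (p x)) univ)⁻¹ * ENNReal.ofReal m) • μ ≤ gibbsProbability μ p := by
  rw [gibbsProbability, ← smul_smul]
  refine Measure.le_iff'.2 fun E => ?_
  simp only [Measure.smul_apply, smul_eq_mul]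
  refine mul_le_mul' le_rfl ?_
  calc ENNReal.ofReal m * μ E = (μ.withDensity fun _ => ENNReal.ofReal m) E := by
        rw [withDensity_const, Measure.smul_apply, smul_eq_mul]
    _ ≤ (μ.withDensity fun x => ENNReal.ofReal (p x)) E :=
        withDensity_mono (Eventually.of_forall fun x => ENNReal.ofReal_le_ofReal (hpm x)) E

end Gibbs

/-! ## §3 A ball sits in every box -/

section Spread

variable {ι : Type*} [Fintype ι] {G : Type*} [TopologicalSpace G] [Group G] [IsTopologicalGroup G]
  [CompactSpace G]

/-- **A ball sits in the box, uniformly**: for a compatible pseudo-metric on `G` (and the sup pseudo-metric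
on `ι → G`) and an open `V' ∋ 1` there is `r > 0` with `B(U, r) ⊆ {W : ∀ j, W_j U_j⁻¹ ∈ V'}` for EVERY
`U` — the uniformity of the compact group is the neighbourhood filter of the diagonal, and
`{(g, u) : g u⁻¹ ∈ V'}` is an open set containing it. -/
theorem exists_ball_subset_box [PseudoMetricSpace G]
    (htop : (inferInstance : PseudoMetricSpace G).toUniformSpace.toTopologicalSpace = ‹TopologicalSpace G›)
    {V' : Set G} (hV'o : IsOpen V') (hV'1 : (1 : G) ∈ V') :
    ∃ r : ℝ, 0 < r ∧ ∀ U W : ι → G, W ∈ ball U r → ∀ j, W j * (U j)⁻¹ ∈ V' := by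
  subst htop
  have hO : {p : G × G | p.1 * p.2⁻¹ ∈ V'} ∈ 𝓤 G := by
    rw [← nhdsSet_diagonal_eq_uniformity]
    refine (hV'o.preimage (continuous_fst.mul continuous_snd.inv)).mem_nhdsSet.2 ?_
    rintro ⟨g, u⟩ hgu
    rw [mem_diagonal_iff] at hgu
    simp only at hgu
    subst hgu
    show g * g⁻¹ ∈ V'
    rwa [mul_inv_cancel]
  obtain ⟨r, hr, hball⟩ := Metric.mem_uniformity_dist.1 hO
  refine ⟨r, hr, fun U W hWU j => ?_⟩
  exact hball ((dist_le_pi_dist W U j).trans_lt (mem_ball.1 hWU))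

end Spread

end Summit.Ventures.LatticeQCDFlow.Exactness
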